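import Summits.QuantumAdvantage.QuantumAdvantage.Theses.SosSandwich
import Summits.QuantumAdvantage.QuantumAdvantage.Theorems.SosSandwichPseudoBoundedAALevelKRung
import HarnessLib

/-!
# Route `SosSandwich`, crux `PseudoBoundedAA` (stmt-QuantumAdvantage-15237): the crux IS its high-level case

The crux `PseudoBoundedAA` (PB-AA: every `p ∈ K_T`, `T ≥ 1`, with `Var[p] ≥ ε > 0` has a variable with
`C (ε/T)^c ≤ Inf_i[p]`) is EQUIVALENT, for every fixed depth `K₀`, to its restriction to pseudo-bounded polynomials
carrying at least half of their variance on the Walsh levels `> K₀`: the bottom levels `1 … K₀` are discharged by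
the general bottom rung (`LevelKRung.exists_influence_ge_levelK`, constants polynomial in `T` for fixed `K₀`).

* `pseudoBoundedAA_levelK_share` — the level-`k` rung on `K_T` in PB-AA shape: a share `η` of the variance on level
  `k` gives `16η²·(ε/T)^{4k-2} ≤ 9^{k-1}(2k+1)²·2^{4k-2}·Inf_i`;
* `pseudoBoundedAA_of_highLevels` — **high-level PB-AA ⟹ `PseudoBoundedAA`** (the route decl, by name);
  `highLevels_of_pseudoBoundedAA` (restriction); `pseudoBoundedAA_iff_highLevels`.

On `K_T` (unlike `Q_T`) no degree-free TOP rung is available (`HomogeneousPBAA` is refuted by the address family;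
`HomogeneousPBAAT`, stmt-27399, is open), so the residual statement keeps all levels `> K₀`.

Honest label: a reduction/equivalence about the crux (planner-facing); no stub, crux or summit is proved.
Sources: Aaronson–Ambainis 2014 Conj. 6; Kaniewski–Lee–de Wolf 2015 Def. 7; O'Donnell 2014 §1.4, Thm. 9.21.
-/

-- D-0017: single-conjunct summit ⇒ the duplicate `QuantumAdvantage.QuantumAdvantage` is mandated.
set_option linter.dupNamespace false

noncomputable section

namespace Summit.QuantumAdvantage.QuantumAdvantage.Theorems.SosSandwich.LevelKRung

open Finset
open Literature.Computability.QuantumComplexity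
open Literature.Computability.Complexity.LowDegree (cubeFourierCoeff)
open Summit.QuantumAdvantage.QuantumAdvantage.Theses.SosSandwich (PseudoBoundedAA)
open Summit.QuantumAdvantage.QuantumAdvantage.Theorems.SosSandwich.LevelOneRung

variable {N : ℕ}

/-! ### The level-`k` rung on `K_T` in PB-AA shape -/

/-- **The level-`k` rung on `K_T` in PB-AA shape.**  For `p ∈ K_T` (`T ≥ 1`) with `Var[p] ≥ ε > 0` and a share
`η > 0` of the variance on level `k ≥ 1` (`η·Var ≤ W_k`): some variable has
`16η²·(ε/T)^{4k-2} ≤ 9^{k-1}(2k+1)²·2^{4k-2}·Inf_i[p]`. [cite: AaronsonAmbainis2014, Conj. 6] [cite: ODonnell2014, Thm. 9.21]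
[cite: KaniewskiLeeDewolf2015, Def. 7] -/
theorem pseudoBoundedAA_levelK_share {k : ℕ} (hk : 1 ≤ k) {T : ℕ} (hT : 1 ≤ T) (p : MvPolynomial (Fin N) ℝ)
    (hpb : PseudoBounded T p) {ε η : ℝ} (hε : 0 < ε) (hv : ε ≤ boolVariance p) (hη : 0 < η)
    (hshare : η * boolVariance p ≤
      ∑ S ∈ univ.filter (fun S : Finset (Fin N) => S.card = k), cubeFourierCoeff (evalBool p) S ^ 2) :
    ∃ i : Fin N, 16 * η ^ 2 * (ε / T) ^ (4 * k - 2) ≤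
      (9 : ℝ) ^ (k - 1) * (2 * k + 1) ^ 2 * (2 : ℝ) ^ (4 * k - 2) * influence i p := by
  classical
  set W := ∑ S ∈ univ.filter (fun S : Finset (Fin N) => S.card = k), cubeFourierCoeff (evalBool p) S ^ 2 with hW
  rcases Nat.eq_zero_or_pos N with hN0 | hN
  · exfalso
    subst hN0
    have h0 : boolVariance p = 0 := by
      unfold boolVariance boolAvg
      rw [Fintype.sum_unique, Fintype.sum_unique]
      simp
    linarith
  obtain ⟨p', hdeg, hb, heq⟩ := exists_representative_of_pseudoBounded hpb
  obtain ⟨i, hi⟩ := exists_influence_ge_levelK hk hN hdeg hb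
  have hinf : influence i p' = influence i p := by unfold influence; rw [heq]
  rw [heq, hinf] at hi
  refine ⟨i, ?_⟩
  have hI := influence_nonneg i p
  have hTpos : (0 : ℝ) < T := by exact_mod_cast hT
  have hε1 : ε ≤ 1 := by
    have := boolVariance_le_quarter hpb
    linarith
  have hWε : η * ε ≤ W := le_trans (mul_le_mul_of_nonneg_left hv hη.le) hshare
  have hW2 : (η * ε) ^ 2 ≤ W ^ 2 := pow_le_pow_left₀ (by positivity) hWε 2
  have hfac : (1 : ℝ) ≤ (k.factorial : ℝ) ^ 2 :=
    one_le_pow₀ (by exact_mod_cast Nat.succ_le_of_lt (Nat.factorial_pos k))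
  have h16 : 16 * (η * ε) ^ 2 ≤ 16 * (k.factorial : ℝ) ^ 2 * W ^ 2 := by nlinarith [sq_nonneg W]
  have hsplit : ((2 * T : ℕ) : ℝ) ^ (4 * k - 2) = (2 : ℝ) ^ (4 * k - 2) * (T : ℝ) ^ (4 * k - 2) := by
    push_cast; rw [mul_pow]
  rw [hsplit] at hi
  have hεpow : ε ^ (4 * k - 2) ≤ ε ^ 2 := pow_le_pow_of_le_one hε.le hε1 (by omega)
  have hTpow : (0 : ℝ) < (T : ℝ) ^ (4 * k - 2) := by positivity
  rw [div_pow]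
  rw [show 16 * η ^ 2 * (ε ^ (4 * k - 2) / (T : ℝ) ^ (4 * k - 2)) =
      16 * η ^ 2 * ε ^ (4 * k - 2) / (T : ℝ) ^ (4 * k - 2) by ring, div_le_iff₀ hTpow]
  calc 16 * η ^ 2 * ε ^ (4 * k - 2) ≤ 16 * η ^ 2 * ε ^ 2 :=
        mul_le_mul_of_nonneg_left hεpow (by positivity)
    _ = 16 * (η * ε) ^ 2 := by ring
    _ ≤ 16 * (k.factorial : ℝ) ^ 2 * W ^ 2 := h16
    _ ≤ (9 : ℝ) ^ (k - 1) * (2 * k + 1) ^ 2 * ((2 : ℝ) ^ (4 * k - 2) * (T : ℝ) ^ (4 * k - 2)) *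
          influence i p := hi
    _ = (9 : ℝ) ^ (k - 1) * (2 * k + 1) ^ 2 * (2 : ℝ) ^ (4 * k - 2) * influence i p * (T : ℝ) ^ (4 * k - 2) := by
        ring

/-- For nonnegative level weights: `Σ_{k=1}^{d} W_k ≤ Σ_{k=1}^{K₀} W_k + Σ_{k=K₀+1}^{d} W_k`. [folklore] -/
theorem sum_levels_le_two_bands (K₀ d : ℕ) (W : ℕ → ℝ) (hW : ∀ k, 0 ≤ W k) :
    ∑ k ∈ Finset.Icc 1 d, W k ≤ ∑ k ∈ Finset.Icc 1 K₀, W k + ∑ k ∈ Finset.Icc (K₀ + 1) d, W k := by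
  classical
  have hpt : ∀ k ∈ Finset.Icc 1 d, W k ≤
      (if k ∈ Finset.Icc 1 K₀ then W k else 0) + (if k ∈ Finset.Icc (K₀ + 1) d then W k else 0) := by
    intro k hk
    rw [Finset.mem_Icc] at hk
    have h0 := hW k
    by_cases h1 : k ≤ K₀
    · rw [if_pos (Finset.mem_Icc.mpr ⟨hk.1, h1⟩)]
      split_ifs <;> linarith
    · rw [if_neg (fun h => h1 (Finset.mem_Icc.mp h).2), if_pos (Finset.mem_Icc.mpr ⟨by omega, hk.2⟩)]
      linarith
  refine (Finset.sum_le_sum hpt).trans ?_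
  rw [Finset.sum_add_distrib]
  have hA : ∑ k ∈ Finset.Icc 1 d, (if k ∈ Finset.Icc 1 K₀ then W k else 0) ≤ ∑ k ∈ Finset.Icc 1 K₀, W k := by
    rw [← Finset.sum_filter]
    exact Finset.sum_le_sum_of_subset_of_nonneg (fun k hk => (Finset.mem_filter.mp hk).2) fun k _ _ => hW k
  have hB : ∑ k ∈ Finset.Icc 1 d, (if k ∈ Finset.Icc (K₀ + 1) d then W k else 0) ≤
      ∑ k ∈ Finset.Icc (K₀ + 1) d, W k := by
    rw [← Finset.sum_filter]
    exact Finset.sum_le_sum_of_subset_of_nonneg (fun k hk => (Finset.mem_filter.mp hk).2) fun k _ _ => hW k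
  linarith

/-! ### High-level PB-AA ⟹ `PseudoBoundedAA` (by name), for every fixed depth `K₀` -/

/-- **High-level PB-AA ⟹ the crux `PseudoBoundedAA`, for every `K₀`.**  HYPOTHESIS: PB-AA asserted only for
pseudo-bounded `p` of order `T ≥ 1` with at least HALF of `Var[p]` on the Walsh levels `K₀+1 … 2T`.  CONCLUSION: the
route decl `PseudoBoundedAA` (literal; its inline cube vocabulary is definitionally the tree's `PseudoBounded`,
`boolVariance`, `influence`).  Cases: half the variance on the bottom levels `1 … K₀` (pigeonhole +
`pseudoBoundedAA_levelK_share`, exponent `4K₀+2`), or on the high levels (hypothesis).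
[cite: AaronsonAmbainis2014, Conj. 6] [cite: KaniewskiLeeDewolf2015, Def. 7] [cite: ODonnell2014, Thm. 9.21] -/
theorem pseudoBoundedAA_of_highLevels (K₀ : ℕ)
    (hHigh : ∃ (c : ℕ) (C : ℝ), 0 < C ∧ ∀ (N T : ℕ) (p : MvPolynomial (Fin N) ℝ) (ε : ℝ),
      1 ≤ T → PseudoBounded T p → 0 < ε → ε ≤ boolVariance p →
      boolVariance p ≤ 2 * ∑ k ∈ Finset.Icc (K₀ + 1) (2 * T),
        ∑ S ∈ univ.filter (fun S : Finset (Fin N) => S.card = k), cubeFourierCoeff (evalBool p) S ^ 2 →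
        ∃ i : Fin N, C * (ε / T) ^ c ≤ influence i p) :
    PseudoBoundedAA := by
  classical
  obtain ⟨c, C, hC, H⟩ := hHigh
  set Γ : ℝ := (9 : ℝ) ^ K₀ * (2 * (K₀ : ℝ) + 3) ^ 2 * (2 : ℝ) ^ (4 * K₀ + 2) with hΓ
  have hΓpos : 0 < Γ := by positivity
  set CB : ℝ := 4 / (((K₀ : ℝ) + 1) ^ 2 * Γ) with hCB
  have hCBpos : 0 < CB := by positivity
  show ∃ (c : ℕ) (C : ℝ), 0 < C ∧ ∀ (N T : ℕ) (p : MvPolynomial (Fin N) ℝ) (ε : ℝ),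
    1 ≤ T → PseudoBounded T p → 0 < ε → ε ≤ boolVariance p → ∃ i : Fin N, C * (ε / T) ^ c ≤ influence i p
  refine ⟨max c (4 * K₀ + 2), min C CB, by positivity, fun N T p ε hT hpb hε hv => ?_⟩
  set c' := max c (4 * K₀ + 2) with hc'
  set C' := min C CB with hC'
  have hC'pos : 0 < C' := by positivity
  have hTpos : (0 : ℝ) < T := by exact_mod_cast hT
  have hv1 : boolVariance p ≤ 1 := by
    have := boolVariance_le_quarter hpb
    linarith
  have hx1 : ε / T ≤ 1 := by
    rw [div_le_one hTpos]
    have : (1 : ℝ) ≤ T := by exact_mod_cast hT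
    linarith [hv.trans hv1]
  have hx0 : 0 ≤ ε / T := by positivity
  have mono : ∀ {C₀ : ℝ} {c₀ : ℕ} {I : ℝ}, C' ≤ C₀ → c₀ ≤ c' → C₀ * (ε / T) ^ c₀ ≤ I → C' * (ε / T) ^ c' ≤ I := by
    intro C₀ c₀ I hCC hcc hI
    have hpow : (ε / T) ^ c' ≤ (ε / T) ^ c₀ := pow_le_pow_of_le_one hx0 hx1 hcc
    calc C' * (ε / T) ^ c' ≤ C₀ * (ε / T) ^ c₀ := mul_le_mul hCC hpow (by positivity) (hC'pos.le.trans hCC)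
      _ ≤ I := hI
  set W : ℕ → ℝ := fun k =>
    ∑ S ∈ univ.filter (fun S : Finset (Fin N) => S.card = k), cubeFourierCoeff (evalBool p) S ^ 2 with hW
  by_cases hhigh : boolVariance p ≤ 2 * ∑ k ∈ Finset.Icc (K₀ + 1) (2 * T), W k
  · obtain ⟨i, hi⟩ := H N T p ε hT hpb hε hv hhigh
    exact ⟨i, mono (by rw [hC']; exact min_le_left _ _) (by rw [hc']; exact le_max_left _ _) hi⟩
  -- the bottom levels `1 … K₀` carry half of the variance
  push Not at hhigh
  have hW0 : ∀ k, 0 ≤ W k := fun k => Finset.sum_nonneg fun S _ => sq_nonneg _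
  obtain ⟨p', hdeg, hb, heq⟩ := exists_representative_of_pseudoBounded hpb
  have hsum : boolVariance p ≤ ∑ k ∈ Finset.Icc 1 (2 * T), W k := by
    have h := boolVariance_le_sum_levels p' fun S hS => cubeFourierCoeff_evalBool_eq_zero hdeg hS
    have hvar : boolVariance p' = boolVariance p := by unfold boolVariance; rw [heq]
    rw [hvar, heq] at h
    exact h
  have hcov := sum_levels_le_two_bands K₀ (2 * T) W hW0
  have hbot : boolVariance p ≤ 2 * ∑ k ∈ Finset.Icc 1 K₀, W k := by linarith
  have hV0 := boolVariance_nonneg p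
  have hK₀ : 1 ≤ K₀ := by
    by_contra h0
    have : K₀ = 0 := by omega
    subst this
    simp at hbot
    linarith
  have hK : (0 : ℝ) < K₀ := by exact_mod_cast hK₀
  have hne : (Finset.Icc 1 K₀).Nonempty := ⟨1, Finset.mem_Icc.mpr ⟨le_rfl, hK₀⟩⟩
  have hpig : ∃ k ∈ Finset.Icc 1 K₀, boolVariance p / (2 * K₀) ≤ W k := by
    apply Finset.exists_le_of_sum_le hne
    rw [Finset.sum_const, Nat.card_Icc, nsmul_eq_mul, show K₀ + 1 - 1 = K₀ by omega]
    have : (K₀ : ℝ) * (boolVariance p / (2 * K₀)) = boolVariance p / 2 := by field_simp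
    rw [this]
    linarith
  obtain ⟨k, hk, hWk⟩ := hpig
  rw [Finset.mem_Icc] at hk
  have hshare : (1 / (2 * K₀) : ℝ) * boolVariance p ≤ W k := by
    rw [show (1 / (2 * K₀) : ℝ) * boolVariance p = boolVariance p / (2 * K₀) by ring]; exact hWk
  obtain ⟨i, hi⟩ := pseudoBoundedAA_levelK_share hk.1 hT p hpb hε hv (by positivity) hshare
  refine ⟨i, mono (C₀ := CB) (c₀ := 4 * K₀ + 2) (by rw [hC']; exact min_le_right _ _)
    (by rw [hc']; exact le_max_right _ _) ?_⟩
  have hI := influence_nonneg i p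
  have h9 : (9 : ℝ) ^ (k - 1) ≤ (9 : ℝ) ^ K₀ := pow_le_pow_right₀ (by norm_num) (by omega)
  have hk2 : ((2 : ℝ) * k + 1) ^ 2 ≤ (2 * (K₀ : ℝ) + 3) ^ 2 := by
    have : (k : ℝ) ≤ K₀ := by exact_mod_cast hk.2
    nlinarith
  have h2 : (2 : ℝ) ^ (4 * k - 2) ≤ (2 : ℝ) ^ (4 * K₀ + 2) := pow_le_pow_right₀ (by norm_num) (by omega)
  have hconst : (9 : ℝ) ^ (k - 1) * (2 * k + 1) ^ 2 * (2 : ℝ) ^ (4 * k - 2) ≤ Γ := by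
    rw [hΓ]; gcongr
  have hpow : (ε / T) ^ (4 * K₀ + 2) ≤ (ε / T) ^ (4 * k - 2) := pow_le_pow_of_le_one hx0 hx1 (by omega)
  have step : 16 * (1 / (2 * K₀) : ℝ) ^ 2 * (ε / T) ^ (4 * K₀ + 2) ≤ Γ * influence i p := by
    calc 16 * (1 / (2 * K₀) : ℝ) ^ 2 * (ε / T) ^ (4 * K₀ + 2)
        ≤ 16 * (1 / (2 * K₀) : ℝ) ^ 2 * (ε / T) ^ (4 * k - 2) := mul_le_mul_of_nonneg_left hpow (by positivity)
      _ ≤ (9 : ℝ) ^ (k - 1) * (2 * k + 1) ^ 2 * (2 : ℝ) ^ (4 * k - 2) * influence i p := hi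
      _ ≤ Γ * influence i p := mul_le_mul_of_nonneg_right hconst hI
  have hxp : 0 ≤ (ε / T) ^ (4 * K₀ + 2) := by positivity
  have hCB_le : CB ≤ 16 * (1 / (2 * K₀) : ℝ) ^ 2 / Γ := by
    have e2 : 16 * (1 / (2 * (K₀ : ℝ))) ^ 2 / Γ = 4 / ((K₀ : ℝ) ^ 2 * Γ) := by
      field_simp
      norm_num
    have hb' : (0 : ℝ) < ((K₀ : ℝ) + 1) ^ 2 * Γ := by positivity
    have hd' : (0 : ℝ) < (K₀ : ℝ) ^ 2 * Γ := mul_pos (pow_pos hK 2) hΓpos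
    rw [hCB, e2, div_le_div_iff_of_pos_left (by norm_num) hb' hd']
    have hsq : (K₀ : ℝ) ^ 2 ≤ ((K₀ : ℝ) + 1) ^ 2 := by nlinarith
    exact mul_le_mul_of_nonneg_right hsq hΓpos.le
  calc CB * (ε / T) ^ (4 * K₀ + 2)
      ≤ 16 * (1 / (2 * K₀) : ℝ) ^ 2 / Γ * (ε / T) ^ (4 * K₀ + 2) := mul_le_mul_of_nonneg_right hCB_le hxp
    _ ≤ influence i p := by
        rw [div_mul_eq_mul_div, div_le_iff₀ hΓpos, mul_comm (influence i p) Γ]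
        exact step

/-- **The converse (restriction): `PseudoBoundedAA` ⟹ high-level PB-AA.** [cite: AaronsonAmbainis2014, Conj. 6] -/
theorem highLevels_of_pseudoBoundedAA (K₀ : ℕ) (h : PseudoBoundedAA) :
    ∃ (c : ℕ) (C : ℝ), 0 < C ∧ ∀ (N T : ℕ) (p : MvPolynomial (Fin N) ℝ) (ε : ℝ),
      1 ≤ T → PseudoBounded T p → 0 < ε → ε ≤ boolVariance p →
      boolVariance p ≤ 2 * ∑ k ∈ Finset.Icc (K₀ + 1) (2 * T),
        ∑ S ∈ univ.filter (fun S : Finset (Fin N) => S.card = k), cubeFourierCoeff (evalBool p) S ^ 2 →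
        ∃ i : Fin N, C * (ε / T) ^ c ≤ influence i p := by
  have h' : ∃ (c : ℕ) (C : ℝ), 0 < C ∧ ∀ (N T : ℕ) (p : MvPolynomial (Fin N) ℝ) (ε : ℝ),
      1 ≤ T → PseudoBounded T p → 0 < ε → ε ≤ boolVariance p → ∃ i : Fin N, C * (ε / T) ^ c ≤ influence i p := h
  obtain ⟨c, C, hC, H⟩ := h'
  exact ⟨c, C, hC, fun N T p ε hT hpb hε hv _ => H N T p ε hT hpb hε hv⟩

/-- **`PseudoBoundedAA` ⟺ high-level PB-AA, for every fixed depth `K₀`.**  The open content of the crux on `K_T`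
is the influence bound for pseudo-bounded polynomials whose variance lives above any fixed Walsh level.
[cite: AaronsonAmbainis2014, Conj. 6] [cite: KaniewskiLeeDewolf2015, Def. 7] -/
theorem pseudoBoundedAA_iff_highLevels (K₀ : ℕ) :
    PseudoBoundedAA ↔
    ∃ (c : ℕ) (C : ℝ), 0 < C ∧ ∀ (N T : ℕ) (p : MvPolynomial (Fin N) ℝ) (ε : ℝ),
      1 ≤ T → PseudoBounded T p → 0 < ε → ε ≤ boolVariance p →
      boolVariance p ≤ 2 * ∑ k ∈ Finset.Icc (K₀ + 1) (2 * T),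
        ∑ S ∈ univ.filter (fun S : Finset (Fin N) => S.card = k), cubeFourierCoeff (evalBool p) S ^ 2 →
        ∃ i : Fin N, C * (ε / T) ^ c ≤ influence i p :=
  ⟨highLevels_of_pseudoBoundedAA K₀, pseudoBoundedAA_of_highLevels K₀⟩

end Summit.QuantumAdvantage.QuantumAdvantage.Theorems.SosSandwich.LevelKRung
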